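import Summits.QuantumFields.YangMills.Theorems.UnitScaleTiltProp7QH1SuRowOfRLegs
import Summits.QuantumFields.YangMills.Theorems.UnitScaleTiltProp7RLegsLinTowerRowsT3
import Summits.QuantumFields.YangMills.Theorems.UnitScaleTiltProp7QH1CentralOfFlat
import Summits.QuantumFields.YangMills.Theorems.UnitScaleTiltProp7QH1CentralRowFlat
import HarnessLib

/-!
# Route `UnitScaleTilt`, crux K1 «MinimiserStabilityRegPr» (stmt-QuantumFields-19200), LANE II, row (QH1)♮ —
# **THE (QH1)♮ ROW IS INHABITED AT THE LETTER OF RECORD: `hQH1_doorH_holds` — the `Q_k^c`-mass of EVERY `M₂(ℂ)`-valued one-form is `H¹`-bounded at every printed-regular member**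

Cell `ym3-torus`, width seat `ym3-torus-px21` (gen 8; ★p1 g20 13:45:32Z «same welcome to px21 for an `h𝔰𝔲_doorH_holds …`»).  THEOREMS ONLY (0 `def`, 0 `sorry`);
`--supports stmt-QuantumFields-19200 --as helper`, count-neutral.  YM₃ on T³ is a ladder rung (R3), not d = 4, not infinite volume, not the Clay problem; nothing here claims the
stub `stub_existenceMinimalOrbit`, the crux, `hN06`, `hPatch`, (REC) or the mass gap.

THE POINT.  The EX display (S36ᴸ∕S37ᴸ) carries the (QH1)♮ row as three rows `hHsplit h𝔰𝔲 hcen` through ✓`Prop7QH1OfSectors.hQH1_of_sectors` (✓p718170), against the free letter `H`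
with sign row `hH0`.  At the letter of record `H := fun F n K W f ↦ c₀ F.L·((F.L:ℝ)^(K−n))²·CURL_HS_W((toL2)⁻¹ f) + ‖DstarL2 F n K (c₀ F.L) W f‖²` (★w2 g9, 2026-08-29 12:55Z) every
one of them is now a tree theorem: `hH0`∕`hHsplit` (✓p722205 `hH0_doorH`∕`hHsplit_doorH`), `h𝔰𝔲` (✓p723296 `h𝔰𝔲_doorH_of_rlegs` ∘ ★px18's ✓`Prop7RLegsLinTowerRowsT3.rlegs_of_regPr`, the
curved corner-frame legs row from `RegPr` alone), `hcen` (★px10's ✓`Prop7QH1CentralOfFlat.hcen_doorH_of_flat` ∘ ★px22's ✓`Prop7QH1CentralRowFlat.hcen_one`).  This file composes them.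

WHAT IS PROVED (ns `…Theorems.Prop7QH1DoorHolds`):
* ★★ `h𝔰𝔲_doorH_holds (c₀ cB)` — ✓p718170's `h𝔰𝔲` binder at `H := H_door`, NO displayed hypothesis.
* ★★★ `hQH1_doorH_holds (c₀ cB)` — ✓p711805 `member_core_row_packaged`'s ∕ the EX face's (S33ᴸ–S35ᴸ) binder `hQH1` at `H := H_door`, for EVERY `f : BondL2K`, NO displayed hypothesis:
  `∀ L>1 ∃ B B′ B″ ≥ 0, eQ > 0, ∀ F (F.L = L) n K (n<K) e W, 0<e → e≤eQ → RegPr F n K e W → ∀ f, (c₀∕cB)·ℓ³·‖Qkc W f‖² ≤ B‖f‖² + B′·H_door F n K W f + B″·e·‖f‖²`.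
HONEST SCOPE.  A two-line composition; the estimates are the cited files' (★px22 QE′-H¹ ✓p715779 + flat rows ✓p712697∕✓p718117∕`hcen_one`, ★px19 ✓p715851 `rlegs_flat`, ★px10 ✓(8)(9)(10),
★px18∕★routeR∕★w4-20520 the curved legs chain, ★px21 the sector door + 𝔰𝔲 knit).  `hEng`, `hPatch`, hN06, (REC), EX and the crux are NOT proved here.

References: T. Bałaban, CMP **99** (1985) 389–434 [Balaban1985BackgroundPropagators] ((3.11) p.392, (3.13)–(3.15) p.393, (3.19)–(3.26) pp.393–395, Thm 3.11 p.416);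
CMP **98** (1985) 17–51 [Balaban1985Averaging] ((89)–(92) p.31, (124)–(127) pp.36–37); CMP **102** (1985) 277–309 [Balaban1985Variational] ((14) p.280, (44)–(45) p.285, (51) p.286);
CMP **95** (1984) 17–40 [Balaban1984PropagatorsI] ((1.18)–(1.20) pp.19–20).
-/

set_option autoImplicit false

noncomputable section

open scoped BigOperators Matrix.Norms.L2Operator Matrix InnerProductSpace ComplexConjugate

namespace Summit.QuantumFields.YangMills.Theorems.Prop7QH1DoorHolds

open Literature.MathematicalPhysics.QuantumFieldTheory.Balaban1983to89
open Literature.MathematicalPhysics.QuantumFieldTheory.Balaban1983to89.T3ContinuumYM3Torus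
open Literature.MathematicalPhysics.QuantumFieldTheory.Balaban1983to89.T3PrintedRegularMinimiser (RegPr)
open B9Eq39Adjoint (curl divB)
open B10Eq27TorusAxialLog (unitsField toUField)
open B9TorusCalculus (torusT)
open B11Eq103H1Complex (BondL2K)
open Summit.QuantumFields.YangMills.Theorems.Prop7SectET3Transport (periodsT3)
open Summit.QuantumFields.YangMills.Theorems.Prop7SectET3HilbertLetters (W₂ toL2 DstarL2)
open Summit.QuantumFields.YangMills.Theorems.Prop7SectET3CombLetters (Qkc)
open Summit.QuantumFields.YangMills.Theorems.Prop7QH1OfSectors (hQH1_of_sectors)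
open Summit.QuantumFields.YangMills.Theorems.Prop7QH1SectorRowsOfH (hHsplit_doorH hH0_doorH)
open Summit.QuantumFields.YangMills.Theorems.Prop7QH1SuRowOfRLegs (h𝔰𝔲_doorH_of_rlegs)
open Summit.QuantumFields.YangMills.Theorems.Prop7RLegsLinTowerRowsT3 (rlegs_of_regPr)
open Summit.QuantumFields.YangMills.Theorems.Prop7QH1CentralOfFlat (hcen_doorH_of_flat)
open Summit.QuantumFields.YangMills.Theorems.Prop7QH1CentralRowFlat (hcen_one)

variable (c₀ cB : ℕ → ℝ) [hc₀ : ∀ L : ℕ, Fact (0 < c₀ L)] [hcB : ∀ L : ℕ, Fact (0 < cB L)]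

/-- ★★ **(QH1)♮-𝔰𝔲 UNCONDITIONAL AT THE DOOR'S `H`** — ✓`h𝔰𝔲_doorH_of_rlegs` at ★px18's ✓`rlegs_of_regPr` (the curved corner-frame legs row from `RegPr` alone).
[cite: Balaban1985BackgroundPropagators, (3.11) p.392, (3.13)–(3.15) p.393; Balaban1985Averaging, (89)–(92) p.31, (124)–(127) pp.36–37] -/
theorem h𝔰𝔲_doorH_holds :
    ∀ (L : ℕ), 1 < L → ∃ B B' B'' eQ : ℝ, 0 ≤ B ∧ 0 ≤ B' ∧ 0 ≤ B'' ∧ 0 < eQ ∧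
      ∀ (F : T3Family), F.L = L → ∀ (n K : ℕ) (hnK : n < K) (e : ℝ) (W : GaugeField (F.P K) 0 (Matrix.specialUnitaryGroup (Fin 2) ℂ)),
        0 < e → e ≤ eQ → RegPr F n K e W →
        ∀ A : PBond (F.P K) 0 → Matrix (Fin 2) (Fin 2) ℂ, (∀ b, A b ∈ skewAdjoint (Matrix (Fin 2) (Fin 2) ℂ)) → (∀ b, (A b).trace = 0) →
          (c₀ F.L / cB F.L) * ((F.L : ℝ) ^ (K - n)) ^ 3 * ‖Qkc F n K hnK.le (c₀ F.L) (cB F.L) W (toL2 F K (c₀ F.L) A)‖ ^ 2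
            ≤ B * ‖toL2 F K (c₀ F.L) A‖ ^ 2
              + B' * (fun (F : T3Family) (n K : ℕ) (W : GaugeField (F.P K) 0 (Matrix.specialUnitaryGroup (Fin 2) ℂ)) (f : BondL2K ℂ 3 (periodsT3 F K) (c₀ F.L) W₂) =>
                c₀ F.L * ((F.L : ℝ) ^ (K - n)) ^ 2 * (∑ x : Site (F.P K) 0, ∑ μ : Fin (F.P K).d, ∑ ν : Fin (F.P K).d,
                    (if μ < ν then ∑ j : Fin 2, ∑ k : Fin 2,
                      ‖(curl (torusT (F.P K) 0) (fun κ z => unitsField (toUField W) ⟨z, κ⟩) (fun κ z => (toL2 F K (c₀ F.L)).symm f ⟨z, κ⟩) μ ν x) j k‖ ^ 2 else 0))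
                  + ‖DstarL2 F n K (c₀ F.L) W f‖ ^ 2) F n K W (toL2 F K (c₀ F.L) A)
              + B'' * e * ‖toL2 F K (c₀ F.L) A‖ ^ 2 :=
  h𝔰𝔲_doorH_of_rlegs c₀ cB rlegs_of_regPr

/-- ★★★ **THE (QH1)♮ ROW AT THE LETTER OF RECORD, FOR EVERY ONE-FORM, UNCONDITIONALLY** — ✓`hQH1_of_sectors` with `H := H_door`, `hH0 := hH0_doorH`, `hHsplit := hHsplit_doorH`,
`h𝔰𝔲 := h𝔰𝔲_doorH_holds`, `hcen := hcen_doorH_of_flat (hcen_one)`.  Statement = the EX face's `hQH1` binder (S33ᴸ–S35ᴸ; ✓p711805 `member_core_row_packaged`) at `H := H_door`.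
[cite: Balaban1985BackgroundPropagators, (3.11) p.392, (3.14) p.393, (3.19)–(3.26) pp.393–395; Balaban1985Variational, (44)–(45) p.285, (51) p.286] -/
theorem hQH1_doorH_holds :
    ∀ (L : ℕ), 1 < L → ∃ B B' B'' eQ : ℝ, 0 ≤ B ∧ 0 ≤ B' ∧ 0 ≤ B'' ∧ 0 < eQ ∧
      ∀ (F : T3Family), F.L = L → ∀ (n K : ℕ) (hnK : n < K) (e : ℝ) (W : GaugeField (F.P K) 0 (Matrix.specialUnitaryGroup (Fin 2) ℂ)),
        0 < e → e ≤ eQ → RegPr F n K e W →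
        ∀ f : BondL2K ℂ 3 (periodsT3 F K) (c₀ F.L) W₂,
          (c₀ F.L / cB F.L) * ((F.L : ℝ) ^ (K - n)) ^ 3 * ‖Qkc F n K hnK.le (c₀ F.L) (cB F.L) W f‖ ^ 2
            ≤ B * ‖f‖ ^ 2 + B' * (fun (F : T3Family) (n K : ℕ) (W : GaugeField (F.P K) 0 (Matrix.specialUnitaryGroup (Fin 2) ℂ)) (f : BondL2K ℂ 3 (periodsT3 F K) (c₀ F.L) W₂) =>
                    c₀ F.L * ((F.L : ℝ) ^ (K - n)) ^ 2 * (∑ x : Site (F.P K) 0, ∑ μ : Fin (F.P K).d, ∑ ν : Fin (F.P K).d,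
                        (if μ < ν then ∑ j : Fin 2, ∑ k : Fin 2,
                          ‖(curl (torusT (F.P K) 0) (fun κ z => unitsField (toUField W) ⟨z, κ⟩) (fun κ z => (toL2 F K (c₀ F.L)).symm f ⟨z, κ⟩) μ ν x) j k‖ ^ 2 else 0))
                      + ‖DstarL2 F n K (c₀ F.L) W f‖ ^ 2) F n K W f + B'' * e * ‖f‖ ^ 2 :=
  hQH1_of_sectors c₀ cB
    (fun (F : T3Family) (n K : ℕ) (W : GaugeField (F.P K) 0 (Matrix.specialUnitaryGroup (Fin 2) ℂ)) (f : BondL2K ℂ 3 (periodsT3 F K) (c₀ F.L) W₂) =>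
                    c₀ F.L * ((F.L : ℝ) ^ (K - n)) ^ 2 * (∑ x : Site (F.P K) 0, ∑ μ : Fin (F.P K).d, ∑ ν : Fin (F.P K).d,
                        (if μ < ν then ∑ j : Fin 2, ∑ k : Fin 2,
                          ‖(curl (torusT (F.P K) 0) (fun κ z => unitsField (toUField W) ⟨z, κ⟩) (fun κ z => (toL2 F K (c₀ F.L)).symm f ⟨z, κ⟩) μ ν x) j k‖ ^ 2 else 0))
                      + ‖DstarL2 F n K (c₀ F.L) W f‖ ^ 2)
    (hH0_doorH c₀) (hHsplit_doorH c₀) (h𝔰𝔲_doorH_holds c₀ cB) (hcen_doorH_of_flat c₀ cB (hcen_one c₀ cB))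

end Summit.QuantumFields.YangMills.Theorems.Prop7QH1DoorHolds

end
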